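import Mathlib
import Literature.NumberTheory.Transcendental.KZProduct
import Summits.KontsevichZagierPeriods.KontsevichZagierPeriods.Theorems.SymplecticScissorsPlanarSAZylevStubTeCalc
import Summits.KontsevichZagierPeriods.KontsevichZagierPeriods.Theorems.InverseLandauTateLiftingIsotropySpace

/-!
# `TateLifting` (stmt-KontsevichZagierPeriods-9129), line `Sketch` — stub 53 `IsotropySpace` (ii):
# the honest reduced configuration representation, and the registered stub

Conjunct (ii) of stub 53 and the assembly of the registered stub `IsotropySpace = (i) ∧ (ii)`:
for a `ℚ`-semialgebraic `σ ⊆ (ℝ³)³` of finite volume, invariant under the diagonal action of `O(3)`,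
the reduced configuration representation `m = [τ, ρ²]`,
`τ = {(ρ, y₃, y₄) | ρ > 0, ((0,0,ρ), y₃, y₄) ∈ σ} ⊆ ℝ⁷`, EXISTS as an honest integral representation
(`tateLifting_isotropySpaceMeridian`). Honesty = three obligations: `τ` is `ℚ`-semialgebraic
(Tarski–Seidenberg preimage of `σ` under a coordinate embedding), `ρ²` is `ℚ`-semialgebraic, and `ρ²`
is absolutely integrable on `τ` — by TONELLI THROUGH THE CHART of the space engine:
`vol(σ ∖ N) = ∫_D |det Ψ′| = ∫_{ℝ²} 4/(1+a²+b²)² · ∫_τ ρ²` (the lintegral change-of-variables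
formula `MeasureTheory.lintegral_image_eq_lintegral_abs_det_fderiv_mul`, then the product structure
`ℝ⁹ ≃ᵐ ℝ² × ℝ⁷` of `KZ.appendMeasurableEquiv`), and the first factor is positive, so `∫_τ ρ² < ∞`.
Then `tateLifting_isotropySpace` is the registered stub verbatim (conjunct (i) =
`tateLifting_isotropySpaceMove` = HardSphereVirial's `IsotropyFactorisation3`).

No definitions (pure proof file). References: M. Kontsevich, D. Zagier, *Periods* (2001), §1.2;
J. Bochnak, M. Coste, M.-F. Roy, *Real Algebraic Geometry* (1998), Prop. 2.2.7.
-/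

noncomputable section

open MeasureTheory Set
open Literature.NumberTheory.Transcendental
open Literature.ModelTheory.ExponentialFields (IsSemialgebraic isSemialgebraic_setOf_eval_pos
  isSemialgebraic_univ)

namespace Summit.KontsevichZagierPeriods.InverseLandau

namespace IsotropySpace

open MvPolynomial (aeval X C)

/-- The reduced domain `D = {w | w 2 > 0, ((0,0,w 2), (w 3,w 4,w 5), (w 6,w 7,w 8)) ∈ σ} ⊆ ℝ⁹` is
`ℚ`-semialgebraic for `ℚ`-semialgebraic `σ` (preimage under a polynomial map). [cite: BCR1998, Prop. 2.2.7] -/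
theorem isSemialgebraic_reducedDomain {σ : Set (Fin 9 → ℝ)} (hσ : IsSemialgebraic ℚ σ) :
    IsSemialgebraic ℚ {w : Fin 9 → ℝ | 0 < w 2 ∧
      (![0, 0, w 2, w 3, w 4, w 5, w 6, w 7, w 8] : Fin 9 → ℝ) ∈ σ} := by
  have hι : IsSemialgebraicMapOn ℚ (univ : Set (Fin 9 → ℝ))
      (fun w : Fin 9 → ℝ => (![0, 0, w 2, w 3, w 4, w 5, w 6, w 7, w 8] : Fin 9 → ℝ)) := by
    refine IsSemialgebraicMapOn.of_forall isSemialgebraic_univ fun j => ?_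
    fin_cases j
    · simpa using isSemialgebraicFunOn_aeval (isSemialgebraic_univ (k := ℚ) (ι := Fin 9) (R := ℝ))
        (0 : MvPolynomial (Fin 9) ℚ)
    · simpa using isSemialgebraicFunOn_aeval (isSemialgebraic_univ (k := ℚ) (ι := Fin 9) (R := ℝ))
        (0 : MvPolynomial (Fin 9) ℚ)
    all_goals
      first
      | simpa using isSemialgebraicFunOn_aeval (isSemialgebraic_univ (k := ℚ) (ι := Fin 9) (R := ℝ))
          (X 2 : MvPolynomial (Fin 9) ℚ)
      | simpa using isSemialgebraicFunOn_aeval (isSemialgebraic_univ (k := ℚ) (ι := Fin 9) (R := ℝ))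
          (X 3 : MvPolynomial (Fin 9) ℚ)
      | simpa using isSemialgebraicFunOn_aeval (isSemialgebraic_univ (k := ℚ) (ι := Fin 9) (R := ℝ))
          (X 4 : MvPolynomial (Fin 9) ℚ)
      | simpa using isSemialgebraicFunOn_aeval (isSemialgebraic_univ (k := ℚ) (ι := Fin 9) (R := ℝ))
          (X 5 : MvPolynomial (Fin 9) ℚ)
      | simpa using isSemialgebraicFunOn_aeval (isSemialgebraic_univ (k := ℚ) (ι := Fin 9) (R := ℝ))
          (X 6 : MvPolynomial (Fin 9) ℚ)
      | simpa using isSemialgebraicFunOn_aeval (isSemialgebraic_univ (k := ℚ) (ι := Fin 9) (R := ℝ))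
          (X 7 : MvPolynomial (Fin 9) ℚ)
      | simpa using isSemialgebraicFunOn_aeval (isSemialgebraic_univ (k := ℚ) (ι := Fin 9) (R := ℝ))
          (X 8 : MvPolynomial (Fin 9) ℚ)
  have h1 := Summit.KontsevichZagierPeriods.SymplecticScissors.PlanarSAZylev.teCalc_isSemialgebraic_preimage
    hι hσ
  have h2 := isSemialgebraic_setOf_eval_pos (k := ℚ) (R := ℝ) (X 2 : MvPolynomial (Fin 9) ℚ)
  simp only [MvPolynomial.aeval_X] at h2
  convert h2.inter h1 using 1
  ext w
  simp

/-- The reduced configuration set `τ = {(ρ, y₃, y₄) | ρ > 0, ((0,0,ρ), y₃, y₄) ∈ σ} ⊆ ℝ⁷` is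
`ℚ`-semialgebraic for `ℚ`-semialgebraic `σ`. [cite: BCR1998, Prop. 2.2.7] -/
theorem isSemialgebraic_configDomain {σ : Set (Fin 9 → ℝ)} (hσ : IsSemialgebraic ℚ σ) :
    IsSemialgebraic ℚ {p : Fin 7 → ℝ | 0 < p 0 ∧
      (![0, 0, p 0, p 1, p 2, p 3, p 4, p 5, p 6] : Fin 9 → ℝ) ∈ σ} := by
  have hι : IsSemialgebraicMapOn ℚ (univ : Set (Fin 7 → ℝ))
      (fun p : Fin 7 → ℝ => (![0, 0, p 0, p 1, p 2, p 3, p 4, p 5, p 6] : Fin 9 → ℝ)) := by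
    refine IsSemialgebraicMapOn.of_forall isSemialgebraic_univ fun j => ?_
    fin_cases j
    · simpa using isSemialgebraicFunOn_aeval (isSemialgebraic_univ (k := ℚ) (ι := Fin 7) (R := ℝ))
        (0 : MvPolynomial (Fin 7) ℚ)
    · simpa using isSemialgebraicFunOn_aeval (isSemialgebraic_univ (k := ℚ) (ι := Fin 7) (R := ℝ))
        (0 : MvPolynomial (Fin 7) ℚ)
    all_goals
      first
      | simpa using isSemialgebraicFunOn_aeval (isSemialgebraic_univ (k := ℚ) (ι := Fin 7) (R := ℝ))
          (X 0 : MvPolynomial (Fin 7) ℚ)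
      | simpa using isSemialgebraicFunOn_aeval (isSemialgebraic_univ (k := ℚ) (ι := Fin 7) (R := ℝ))
          (X 1 : MvPolynomial (Fin 7) ℚ)
      | simpa using isSemialgebraicFunOn_aeval (isSemialgebraic_univ (k := ℚ) (ι := Fin 7) (R := ℝ))
          (X 2 : MvPolynomial (Fin 7) ℚ)
      | simpa using isSemialgebraicFunOn_aeval (isSemialgebraic_univ (k := ℚ) (ι := Fin 7) (R := ℝ))
          (X 3 : MvPolynomial (Fin 7) ℚ)
      | simpa using isSemialgebraicFunOn_aeval (isSemialgebraic_univ (k := ℚ) (ι := Fin 7) (R := ℝ))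
          (X 4 : MvPolynomial (Fin 7) ℚ)
      | simpa using isSemialgebraicFunOn_aeval (isSemialgebraic_univ (k := ℚ) (ι := Fin 7) (R := ℝ))
          (X 5 : MvPolynomial (Fin 7) ℚ)
      | simpa using isSemialgebraicFunOn_aeval (isSemialgebraic_univ (k := ℚ) (ι := Fin 7) (R := ℝ))
          (X 6 : MvPolynomial (Fin 7) ℚ)
  have h1 := Summit.KontsevichZagierPeriods.SymplecticScissors.PlanarSAZylev.teCalc_isSemialgebraic_preimage
    hι hσ
  have h2 := isSemialgebraic_setOf_eval_pos (k := ℚ) (R := ℝ) (X 0 : MvPolynomial (Fin 7) ℚ)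
  simp only [MvPolynomial.aeval_X] at h2
  convert h2.inter h1 using 1
  ext w
  simp

/-- **Volume through the chart.** For `O(3)`-invariant `σ`, the volume of `σ` off the closed southern
axis of the first point equals the lintegral of the Jacobian `4ρ²/(1+a²+b²)²` over the reduced domain
(the lintegral change-of-variables formula along the chart of the space engine; no integrability
needed). [cite: KontsevichZagier2001, §1.2 rule (2)] -/
theorem volume_diff_axis_eq_lintegral (σ : Set (Fin 9 → ℝ))
    (hDm : MeasurableSet {w : Fin 9 → ℝ | 0 < w 2 ∧
      (![0, 0, w 2, w 3, w 4, w 5, w 6, w 7, w 8] : Fin 9 → ℝ) ∈ σ})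
    (hO : ∀ R : Matrix (Fin 3) (Fin 3) ℝ, R.transpose * R = 1 → ∀ x : Fin 9 → ℝ,
      x ∈ σ ↔ (![(R.mulVec ![x 0, x 1, x 2]) 0, (R.mulVec ![x 0, x 1, x 2]) 1, (R.mulVec ![x 0, x 1, x 2]) 2,
        (R.mulVec ![x 3, x 4, x 5]) 0, (R.mulVec ![x 3, x 4, x 5]) 1, (R.mulVec ![x 3, x 4, x 5]) 2,
        (R.mulVec ![x 6, x 7, x 8]) 0, (R.mulVec ![x 6, x 7, x 8]) 1, (R.mulVec ![x 6, x 7, x 8]) 2] :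
          Fin 9 → ℝ) ∈ σ) :
    volume (σ \ {x | x 0 = 0 ∧ x 1 = 0 ∧ x 2 ≤ 0}) =
      ∫⁻ w in {w : Fin 9 → ℝ | 0 < w 2 ∧ (![0, 0, w 2, w 3, w 4, w 5, w 6, w 7, w 8] : Fin 9 → ℝ) ∈ σ},
        ENNReal.ofReal (4 * w 2 ^ 2 / (1 + w 0 ^ 2 + w 1 ^ 2) ^ 2) := by
  obtain ⟨p, hp⟩ : ∃ p : ℝ → ℝ → ℝ, ∀ a b, p a b = 2 * a / (1 + a ^ 2 + b ^ 2) := ⟨_, fun _ _ => rfl⟩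
  obtain ⟨q', hq'⟩ : ∃ q' : ℝ → ℝ → ℝ, ∀ a b, q' a b = 2 * b / (1 + a ^ 2 + b ^ 2) := ⟨_, fun _ _ => rfl⟩
  obtain ⟨t, ht⟩ : ∃ t : ℝ → ℝ → ℝ, ∀ a b, t a b = (1 - a ^ 2 - b ^ 2) / (1 + a ^ 2 + b ^ 2) :=
    ⟨_, fun _ _ => rfl⟩
  obtain ⟨e, he⟩ : ∃ e : ℝ → ℝ → ℝ, ∀ a b, e a b = (a ^ 2 - b ^ 2 - 1) / (1 + a ^ 2 + b ^ 2) :=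
    ⟨_, fun _ _ => rfl⟩
  obtain ⟨f, hf⟩ : ∃ f : ℝ → ℝ → ℝ, ∀ a b, f a b = (b ^ 2 - a ^ 2 - 1) / (1 + a ^ 2 + b ^ 2) :=
    ⟨_, fun _ _ => rfl⟩
  obtain ⟨g, hg⟩ : ∃ g : ℝ → ℝ → ℝ, ∀ a b, g a b = 2 * a * b / (1 + a ^ 2 + b ^ 2) := ⟨_, fun _ _ => rfl⟩
  obtain ⟨pa, hpa⟩ : ∃ pa : ℝ → ℝ → ℝ, ∀ a b, pa a b = (2 + 2 * b ^ 2 - 2 * a ^ 2) / (1 + a ^ 2 + b ^ 2) ^ 2 :=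
    ⟨_, fun _ _ => rfl⟩
  obtain ⟨pb, hpb⟩ : ∃ pb : ℝ → ℝ → ℝ, ∀ a b, pb a b = -(4 * a * b) / (1 + a ^ 2 + b ^ 2) ^ 2 :=
    ⟨_, fun _ _ => rfl⟩
  obtain ⟨qa, hqa⟩ : ∃ qa : ℝ → ℝ → ℝ, ∀ a b, qa a b = -(4 * a * b) / (1 + a ^ 2 + b ^ 2) ^ 2 :=
    ⟨_, fun _ _ => rfl⟩
  obtain ⟨qb, hqb⟩ : ∃ qb : ℝ → ℝ → ℝ, ∀ a b, qb a b = (2 + 2 * a ^ 2 - 2 * b ^ 2) / (1 + a ^ 2 + b ^ 2) ^ 2 :=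
    ⟨_, fun _ _ => rfl⟩
  obtain ⟨ta, hta⟩ : ∃ ta : ℝ → ℝ → ℝ, ∀ a b, ta a b = -(4 * a) / (1 + a ^ 2 + b ^ 2) ^ 2 :=
    ⟨_, fun _ _ => rfl⟩
  obtain ⟨tb, htb⟩ : ∃ tb : ℝ → ℝ → ℝ, ∀ a b, tb a b = -(4 * b) / (1 + a ^ 2 + b ^ 2) ^ 2 :=
    ⟨_, fun _ _ => rfl⟩
  obtain ⟨ea, hea⟩ : ∃ ea : ℝ → ℝ → ℝ, ∀ a b, ea a b = 4 * a * (1 + b ^ 2) / (1 + a ^ 2 + b ^ 2) ^ 2 :=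
    ⟨_, fun _ _ => rfl⟩
  obtain ⟨eb, heb⟩ : ∃ eb : ℝ → ℝ → ℝ, ∀ a b, eb a b = -(4 * a ^ 2 * b) / (1 + a ^ 2 + b ^ 2) ^ 2 :=
    ⟨_, fun _ _ => rfl⟩
  obtain ⟨fa, hfa⟩ : ∃ fa : ℝ → ℝ → ℝ, ∀ a b, fa a b = -(4 * a * b ^ 2) / (1 + a ^ 2 + b ^ 2) ^ 2 :=
    ⟨_, fun _ _ => rfl⟩
  obtain ⟨fb, hfb⟩ : ∃ fb : ℝ → ℝ → ℝ, ∀ a b, fb a b = 4 * b * (1 + a ^ 2) / (1 + a ^ 2 + b ^ 2) ^ 2 :=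
    ⟨_, fun _ _ => rfl⟩
  obtain ⟨ga, hga⟩ : ∃ ga : ℝ → ℝ → ℝ, ∀ a b, ga a b = 2 * b * (1 + b ^ 2 - a ^ 2) / (1 + a ^ 2 + b ^ 2) ^ 2 :=
    ⟨_, fun _ _ => rfl⟩
  obtain ⟨gb, hgb⟩ : ∃ gb : ℝ → ℝ → ℝ, ∀ a b, gb a b = 2 * a * (1 + a ^ 2 - b ^ 2) / (1 + a ^ 2 + b ^ 2) ^ 2 :=
    ⟨_, fun _ _ => rfl⟩
  obtain ⟨Ψ, hΨ⟩ : ∃ Ψ : (Fin 9 → ℝ) → Fin 9 → ℝ, ∀ w, Ψ w = ![w 2 * p (w 0) (w 1), w 2 * q' (w 0) (w 1),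
      w 2 * t (w 0) (w 1), e (w 0) (w 1) * w 3 + g (w 0) (w 1) * w 4 + p (w 0) (w 1) * w 5,
      g (w 0) (w 1) * w 3 + f (w 0) (w 1) * w 4 + q' (w 0) (w 1) * w 5,
      p (w 0) (w 1) * w 3 + q' (w 0) (w 1) * w 4 + t (w 0) (w 1) * w 5,
      e (w 0) (w 1) * w 6 + g (w 0) (w 1) * w 7 + p (w 0) (w 1) * w 8,
      g (w 0) (w 1) * w 6 + f (w 0) (w 1) * w 7 + q' (w 0) (w 1) * w 8,
      p (w 0) (w 1) * w 6 + q' (w 0) (w 1) * w 7 + t (w 0) (w 1) * w 8] := ⟨_, fun _ => rfl⟩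
  obtain ⟨Ψ', hΨ'⟩ : ∃ Ψ' : (Fin 9 → ℝ) → (Fin 9 → ℝ) →L[ℝ] (Fin 9 → ℝ), ∀ x, Ψ' x =
      LinearMap.toContinuousLinearMap (Matrix.toLin'
        (Matrix.reindex finSumFinEquiv finSumFinEquiv
          (Matrix.fromBlocks
            !![x 2 * pa (x 0) (x 1), x 2 * pb (x 0) (x 1), p (x 0) (x 1);
               x 2 * qa (x 0) (x 1), x 2 * qb (x 0) (x 1), q' (x 0) (x 1);
               x 2 * ta (x 0) (x 1), x 2 * tb (x 0) (x 1), t (x 0) (x 1)]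
            0
            !![ea (x 0) (x 1) * x 3 + ga (x 0) (x 1) * x 4 + pa (x 0) (x 1) * x 5,
                 eb (x 0) (x 1) * x 3 + gb (x 0) (x 1) * x 4 + pb (x 0) (x 1) * x 5, 0;
               ga (x 0) (x 1) * x 3 + fa (x 0) (x 1) * x 4 + qa (x 0) (x 1) * x 5,
                 gb (x 0) (x 1) * x 3 + fb (x 0) (x 1) * x 4 + qb (x 0) (x 1) * x 5, 0;
               pa (x 0) (x 1) * x 3 + qa (x 0) (x 1) * x 4 + ta (x 0) (x 1) * x 5,
                 pb (x 0) (x 1) * x 3 + qb (x 0) (x 1) * x 4 + tb (x 0) (x 1) * x 5, 0;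
               ea (x 0) (x 1) * x 6 + ga (x 0) (x 1) * x 7 + pa (x 0) (x 1) * x 8,
                 eb (x 0) (x 1) * x 6 + gb (x 0) (x 1) * x 7 + pb (x 0) (x 1) * x 8, 0;
               ga (x 0) (x 1) * x 6 + fa (x 0) (x 1) * x 7 + qa (x 0) (x 1) * x 8,
                 gb (x 0) (x 1) * x 6 + fb (x 0) (x 1) * x 7 + qb (x 0) (x 1) * x 8, 0;
               pa (x 0) (x 1) * x 6 + qa (x 0) (x 1) * x 7 + ta (x 0) (x 1) * x 8,
                 pb (x 0) (x 1) * x 6 + qb (x 0) (x 1) * x 7 + tb (x 0) (x 1) * x 8, 0]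
            (Matrix.reindex finSumFinEquiv finSumFinEquiv
              (Matrix.fromBlocks
                !![e (x 0) (x 1), g (x 0) (x 1), p (x 0) (x 1);
                   g (x 0) (x 1), f (x 0) (x 1), q' (x 0) (x 1);
                   p (x 0) (x 1), q' (x 0) (x 1), t (x 0) (x 1)]
                0 0
                !![e (x 0) (x 1), g (x 0) (x 1), p (x 0) (x 1);
                   g (x 0) (x 1), f (x 0) (x 1), q' (x 0) (x 1);
                   p (x 0) (x 1), q' (x 0) (x 1), t (x 0) (x 1)]))) : Matrix (Fin 9) (Fin 9) ℝ)) :=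
    ⟨_, fun _ => rfl⟩
  have himage := chart_image hp hq' ht he hf hg hΨ σ hO
  have hcov := lintegral_image_eq_lintegral_abs_det_fderiv_mul volume hDm
    (fun x _ => (chart_hasFDerivAt hp hq' ht he hf hg hpa hpb hqa hqb hta htb hea heb hfa hfb hga hgb
      hΨ hΨ' x).hasFDerivWithinAt)
    ((chart_injOn hp hq' ht he hf hg hΨ).mono fun w hw => hw.1) (fun _ => 1)
  rw [setLIntegral_one, himage] at hcov
  rw [hcov]
  refine setLIntegral_congr_fun hDm fun x _ => ?_
  rw [mul_one, chart_det hp hq' ht he hf hg hpa hpb hqa hqb hta htb hΨ' x, abs_of_nonneg (by positivity)]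

end IsotropySpace

open IsotropySpace in
/-- **The honest reduced configuration representation** (conjunct (ii) of stub 53 `IsotropySpace`).
For a `ℚ`-semialgebraic `σ ⊆ (ℝ³)³` invariant under the diagonal action of `O(3)` and carrying an
integrand-`1` representation (so of finite volume), `m = [τ, ρ²]`,
`τ = {(ρ, y₃, y₄) | ρ > 0, ((0,0,ρ), y₃, y₄) ∈ σ}`, exists as an honest integral representation:
`∫_τ ρ² < ∞` because `vol σ ≥ vol(σ ∖ N) = (∫_{ℝ²} 4/(1+a²+b²)²) · ∫_τ ρ²` (Tonelli through the chart)
with a positive first factor. [cite: KontsevichZagier2001, §1.2] -/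
theorem tateLifting_isotropySpaceMeridian :
    ∀ (σ : Set (Fin 9 → ℝ)), IsSemialgebraic ℚ σ →
      (∀ R : Matrix (Fin 3) (Fin 3) ℝ, R.transpose * R = 1 → ∀ x : Fin 9 → ℝ, x ∈ σ ↔ (![(R.mulVec ![x 0, x 1, x 2]) 0, (R.mulVec ![x 0, x 1, x 2]) 1, (R.mulVec ![x 0, x 1, x 2]) 2, (R.mulVec ![x 3, x 4, x 5]) 0, (R.mulVec ![x 3, x 4, x 5]) 1, (R.mulVec ![x 3, x 4, x 5]) 2, (R.mulVec ![x 6, x 7, x 8]) 0, (R.mulVec ![x 6, x 7, x 8]) 1, (R.mulVec ![x 6, x 7, x 8]) 2] : Fin 9 → ℝ) ∈ σ) →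
      ∀ (r : KZ.IntegralRep 9), r.domain = σ → (∀ x ∈ r.domain, r.integrand x = 1) →
      ∃ m : KZ.IntegralRep 7,
        m.domain = {p | 0 < p 0 ∧ (![0, 0, p 0, p 1, p 2, p 3, p 4, p 5, p 6] : Fin 9 → ℝ) ∈ σ} ∧
        (m.integrand = fun p => p 0 ^ 2) := by
  intro σ hσ hO r hr hr1
  have hτ := isSemialgebraic_configDomain hσ
  have hD := isSemialgebraic_reducedDomain hσ
  have hDm := IsSemialgebraic.measurableSet_holds hD
  have hτm := IsSemialgebraic.measurableSet_holds hτ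
  -- `ρ²` is semialgebraic on `τ`
  have hsa : IsSemialgebraicFunOn ℚ {p : Fin 7 → ℝ | 0 < p 0 ∧
      (![0, 0, p 0, p 1, p 2, p 3, p 4, p 5, p 6] : Fin 9 → ℝ) ∈ σ} (fun p => p 0 ^ 2) := by
    exact (isSemialgebraicFunOn_aeval hτ (MvPolynomial.X 0 ^ 2 : MvPolynomial (Fin 7) ℚ)).congr fun x _ => by
      simp only [map_pow, MvPolynomial.aeval_X]
  -- finiteness of the volume of `σ`
  have hfin : volume σ < ⊤ := by
    have h1 : IntegrableOn (fun _ => (1 : ℝ)) σ := by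
      refine (hr ▸ r.integrableOn).congr_fun (fun x hx => hr1 x (hr ▸ hx)) ?_
      exact hr ▸ KZ.IntegralRep.measurableSet_domain_holds r
    rcases (integrableOn_const_iff (C := (1 : ℝ))).1 h1 with h | h
    · simp at h
    · exact h
  -- the Jacobian lintegral over the reduced domain is finite
  have hlt : ∫⁻ w in {w : Fin 9 → ℝ | 0 < w 2 ∧
      (![0, 0, w 2, w 3, w 4, w 5, w 6, w 7, w 8] : Fin 9 → ℝ) ∈ σ},
        ENNReal.ofReal (4 * w 2 ^ 2 / (1 + w 0 ^ 2 + w 1 ^ 2) ^ 2) < ⊤ := by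
    rw [← volume_diff_axis_eq_lintegral σ hDm hO]
    exact (measure_mono fun x hx => hx.1).trans_lt hfin
  -- split `ℝ⁹ ≃ ℝ² × ℝ⁷` (Tonelli)
  have a0 : ∀ (u : Fin 2 → ℝ) (v : Fin 7 → ℝ), Fin.append u v 0 = u 0 := fun u v => Fin.append_left u v 0
  have a1 : ∀ (u : Fin 2 → ℝ) (v : Fin 7 → ℝ), Fin.append u v 1 = u 1 := fun u v => Fin.append_left u v 1
  have b0 : ∀ (u : Fin 2 → ℝ) (v : Fin 7 → ℝ), Fin.append u v 2 = v 0 := fun u v => Fin.append_right u v 0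
  have b1 : ∀ (u : Fin 2 → ℝ) (v : Fin 7 → ℝ), Fin.append u v 3 = v 1 := fun u v => Fin.append_right u v 1
  have b2 : ∀ (u : Fin 2 → ℝ) (v : Fin 7 → ℝ), Fin.append u v 4 = v 2 := fun u v => Fin.append_right u v 2
  have b3 : ∀ (u : Fin 2 → ℝ) (v : Fin 7 → ℝ), Fin.append u v 5 = v 3 := fun u v => Fin.append_right u v 3
  have b4 : ∀ (u : Fin 2 → ℝ) (v : Fin 7 → ℝ), Fin.append u v 6 = v 4 := fun u v => Fin.append_right u v 4
  have b5 : ∀ (u : Fin 2 → ℝ) (v : Fin 7 → ℝ), Fin.append u v 7 = v 5 := fun u v => Fin.append_right u v 5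
  have b6 : ∀ (u : Fin 2 → ℝ) (v : Fin 7 → ℝ), Fin.append u v 8 = v 6 := fun u v => Fin.append_right u v 6
  have hpre : (KZ.appendMeasurableEquiv 2 7) ⁻¹' {w : Fin 9 → ℝ | 0 < w 2 ∧
      (![0, 0, w 2, w 3, w 4, w 5, w 6, w 7, w 8] : Fin 9 → ℝ) ∈ σ} =
      (univ : Set (Fin 2 → ℝ)) ×ˢ {p : Fin 7 → ℝ | 0 < p 0 ∧
        (![0, 0, p 0, p 1, p 2, p 3, p 4, p 5, p 6] : Fin 9 → ℝ) ∈ σ} := by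
    ext ⟨u, v⟩
    simp only [mem_preimage, KZ.appendMeasurableEquiv_apply, mem_setOf_eq, mem_prod, mem_univ, true_and,
      b0, b1, b2, b3, b4, b5, b6]
  have key : ∫⁻ w in {w : Fin 9 → ℝ | 0 < w 2 ∧
      (![0, 0, w 2, w 3, w 4, w 5, w 6, w 7, w 8] : Fin 9 → ℝ) ∈ σ},
        ENNReal.ofReal (4 * w 2 ^ 2 / (1 + w 0 ^ 2 + w 1 ^ 2) ^ 2) =
      (∫⁻ u : Fin 2 → ℝ, ENNReal.ofReal (4 / (1 + u 0 ^ 2 + u 1 ^ 2) ^ 2)) *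
        ∫⁻ p in {p : Fin 7 → ℝ | 0 < p 0 ∧
          (![0, 0, p 0, p 1, p 2, p 3, p 4, p 5, p 6] : Fin 9 → ℝ) ∈ σ}, ENNReal.ofReal (p 0 ^ 2) := by
    rw [← (KZ.volume_preserving_appendMeasurableEquiv (n := 2) (m := 7)).setLIntegral_comp_preimage_emb
      (KZ.appendMeasurableEquiv 2 7).measurableEmbedding, hpre, Measure.volume_eq_prod,
      ← Measure.prod_restrict, Measure.restrict_univ]
    have hfg : ∀ z : (Fin 2 → ℝ) × (Fin 7 → ℝ),
        ENNReal.ofReal (4 * (KZ.appendMeasurableEquiv 2 7 z) 2 ^ 2 /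
          (1 + (KZ.appendMeasurableEquiv 2 7 z) 0 ^ 2 + (KZ.appendMeasurableEquiv 2 7 z) 1 ^ 2) ^ 2) =
        ENNReal.ofReal (4 / (1 + z.1 0 ^ 2 + z.1 1 ^ 2) ^ 2) * ENNReal.ofReal (z.2 0 ^ 2) := by
      rintro ⟨u, v⟩
      rw [KZ.appendMeasurableEquiv_apply, ← ENNReal.ofReal_mul (by positivity)]
      simp only [a0, a1, b0]
      congr 1
      ring
    simp_rw [hfg]
    exact lintegral_prod_mul (f := fun u : Fin 2 → ℝ => ENNReal.ofReal (4 / (1 + u 0 ^ 2 + u 1 ^ 2) ^ 2))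
      (g := fun v : Fin 7 → ℝ => ENNReal.ofReal (v 0 ^ 2)) (by fun_prop)
      (Measurable.aemeasurable (by fun_prop))
  -- the first factor is positive
  have hpos : (∫⁻ u : Fin 2 → ℝ, ENNReal.ofReal (4 / (1 + u 0 ^ 2 + u 1 ^ 2) ^ 2)) ≠ 0 := by
    have hmeas : Measurable fun u : Fin 2 → ℝ => ENNReal.ofReal (4 / (1 + u 0 ^ 2 + u 1 ^ 2) ^ 2) := by
      fun_prop
    have hsupp : Function.support (fun u : Fin 2 → ℝ => ENNReal.ofReal (4 / (1 + u 0 ^ 2 + u 1 ^ 2) ^ 2)) =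
        univ := by
      refine eq_univ_of_forall fun u => ?_
      rw [Function.mem_support]
      exact (ENNReal.ofReal_pos.2 (by positivity)).ne'
    have h := (lintegral_pos_iff_support hmeas).2 (by
      rw [hsupp]
      exact isOpen_univ.measure_pos volume univ_nonempty)
    exact h.ne'
  -- hence `∫_τ ρ² < ∞`
  have hb : ∫⁻ p in {p : Fin 7 → ℝ | 0 < p 0 ∧
      (![0, 0, p 0, p 1, p 2, p 3, p 4, p 5, p 6] : Fin 9 → ℝ) ∈ σ}, ENNReal.ofReal (p 0 ^ 2) < ⊤ := by
    rw [key] at hlt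
    rcases ENNReal.mul_lt_top_iff.1 hlt with h | h | h
    · exact h.2
    · exact absurd h hpos
    · rw [h]; exact ENNReal.zero_lt_top
  have hcont : Continuous fun p : Fin 7 → ℝ => p 0 ^ 2 := by fun_prop
  have hint : IntegrableOn (fun p : Fin 7 → ℝ => p 0 ^ 2) {p : Fin 7 → ℝ | 0 < p 0 ∧
      (![0, 0, p 0, p 1, p 2, p 3, p 4, p 5, p 6] : Fin 9 → ℝ) ∈ σ} :=
    ⟨hcont.aestronglyMeasurable, (hasFiniteIntegral_iff_ofReal (ae_of_all _ fun p : Fin 7 → ℝ => sq_nonneg (p 0))).2 hb⟩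
  exact ⟨⟨_, fun p => p 0 ^ 2, hτ, hsa, hint⟩, rfl, rfl⟩

/-- **The space engine, registered stub 53 `IsotropySpace` of line `Sketch`** (verbatim the skeleton's
`IsotropySpace`): (i) `IsotropyFactorisation3` of route HardSphereVirial (stmt-KontsevichZagierPeriods-10457)
— `tateLifting_isotropySpaceMove`; (ii) the honest reduced configuration representation —
`tateLifting_isotropySpaceMeridian`. [cite: KontsevichZagier2001, §1.2 rule (2)] -/
theorem tateLifting_isotropySpace :
  (∀ (σ : Set (Fin 9 → ℝ)), Literature.ModelTheory.ExponentialFields.IsSemialgebraic ℚ σ → (∀ R : Matrix (Fin 3) (Fin 3) ℝ, R.transpose * R = 1 → ∀ x : Fin 9 → ℝ, x ∈ σ ↔ (![(R.mulVec ![x 0, x 1, x 2]) 0, (R.mulVec ![x 0, x 1, x 2]) 1, (R.mulVec ![x 0, x 1, x 2]) 2, (R.mulVec ![x 3, x 4, x 5]) 0, (R.mulVec ![x 3, x 4, x 5]) 1, (R.mulVec ![x 3, x 4, x 5]) 2, (R.mulVec ![x 6, x 7, x 8]) 0, (R.mulVec ![x 6, x 7, x 8]) 1, (R.mulVec ![x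 6, x 7, x 8]) 2] : Fin 9 → ℝ) ∈ σ) → ∀ (r : Literature.NumberTheory.Transcendental.KZ.IntegralRep 9), r.domain = σ → (∀ x ∈ r.domain, r.integrand x = 1) → ∀ (q : Literature.NumberTheory.Transcendental.KZ.IntegralRep 9), q.domain = {w | 0 < w 2 ∧ (![0, 0, w 2, w 3, w 4, w 5, w 6, w 7, w 8] : Fin 9 → ℝ) ∈ σ} → (∀ w ∈ q.domain, q.integrand w = 4 / (1 + w 0 ^ 2 + w 1 ^ 2) ^ 2 * w 2 ^ 2) → Literature.NumberTheory.Transcendental.KZ.of r - Literature.NumberTheory.Transcendental.KZ.of q ∈ Literature.NumberTheory.Transcendental.KZ.relations) ∧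
  (∀ (σ : Set (Fin 9 → ℝ)), IsSemialgebraic ℚ σ →
    (∀ R : Matrix (Fin 3) (Fin 3) ℝ, R.transpose * R = 1 → ∀ x : Fin 9 → ℝ, x ∈ σ ↔ (![(R.mulVec ![x 0, x 1, x 2]) 0, (R.mulVec ![x 0, x 1, x 2]) 1, (R.mulVec ![x 0, x 1, x 2]) 2, (R.mulVec ![x 3, x 4, x 5]) 0, (R.mulVec ![x 3, x 4, x 5]) 1, (R.mulVec ![x 3, x 4, x 5]) 2, (R.mulVec ![x 6, x 7, x 8]) 0, (R.mulVec ![x 6, x 7, x 8]) 1, (R.mulVec ![x 6, x 7, x 8]) 2] : Fin 9 → ℝ) ∈ σ) →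
    ∀ (r : KZ.IntegralRep 9), r.domain = σ → (∀ x ∈ r.domain, r.integrand x = 1) →
    ∃ m : KZ.IntegralRep 7,
      m.domain = {p | 0 < p 0 ∧ (![0, 0, p 0, p 1, p 2, p 3, p 4, p 5, p 6] : Fin 9 → ℝ) ∈ σ} ∧
      (m.integrand = fun p => p 0 ^ 2)) :=
  ⟨tateLifting_isotropySpaceMove, tateLifting_isotropySpaceMeridian⟩

end Summit.KontsevichZagierPeriods.InverseLandau

end
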